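import Literature.NumberTheory.EllipticCurves.TateCurve.NumberFieldUniformizationTwisted
import Literature.NumberTheory.EllipticCurves.TateCurve.MultiplicativeTwistUnramifiedProofs
import Literature.NumberTheory.EllipticCurves.KummerSelmerStructure
import Literature.NumberTheory.EllipticCurves.GreenbergSelmer
import Literature.NumberTheory.EllipticCurves.KodairaNeronUnramifiedInertiaProofs
import Literature.NumberTheory.GaloisRepresentations.ContinuousH1
import Literature.NumberTheory.GaloisRepresentations.DecompositionGroupOfCompletion
import HarnessLib

/-!
# The Tate line `X ≤ E[p]` at a place of multiplicative reduction (`p` odd): inertia acts trivially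
# on `E[p]/X` AND every local Kummer class is represented by an `X`-valued cocycle
# (stub `stub_cartanLocalMult` of line «gl1cartan5», crux `PrintX11a.UpperNonSurjFive`)

Helper file `--supports stmt-BirchSwinnertonDyer-20614` (line gl1cartan5, rev 3, stub D-L
`CartanLocalMult`). Theorems only: no definition, no named fact, no `sorry`.

WHAT. For an elliptic curve `V` over a number field `F`, an odd prime `p`, and a finite place `v`
of multiplicative reduction (`F_v = v.adicCompletion F`, `Γ_{F_v}` acting on
`E(F̄_v) = localPoints V F_v`), there is `X ≤ E[p] = V.geomTorsion p` with `#X ≤ p` such that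
(b) `τ P - P ∈ X` for every `τ` in the inertia group `I_v ≤ Γ_F` of the chosen embedding
(`GreenbergSelmer.inertia v`) and every `P ∈ E[p]` — Serre 1972, §1.12, Cor. of Prop. 13
(`ρ̄|I_v = (χ̄_p ∗; 0 1)`); and (a) every class of the local Kummer condition
`ker (H¹(F_v, E[p]) → H¹(F_v, E(F̄_v)))` (`V.kummerLocalConditionAt p F_v`, the image of
`E(F_v)/p`) is the class of a continuous crossed homomorphism `Γ_{F_v} → E[p]` valued in `X`.

HOW. Silverman, *ATAEC*, V.3.1, V.5.2 (c), V.5.3, V.5.4 through the tree's PROVED twisted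
uniformisation `TateCurve.Silverman1994_thmV53_corV54_tateUniformisation_holds`
(`Ψ : F̄_vˣ ↠ E(F̄_v)`, `ker Ψ = q^ℤ`, `σ • Ψ(u) = ± Ψ(σu)` with `+` iff `σ t = t`, `t² = -c₄/c₆`,
rational points `= Ψ(u)` with `u ∈ F_v(t)`); `X = E[p] ∩ Ψ(μ_p)`, `#X ≤ #μ_p ≤ p`. (b): inertia
fixes `t` (`TateCurve.toAlgEquiv_eq_of_mem_inertia_of_sq_eq_gamma`, `I_𝔐 = absInertia F_v`), and
`σ • Ψ(w) - Ψ(w) = Ψ(σw/w)`, `(σw/w)^p = σ(q^n)/q^n = 1` for `w^p = q^n`. (a): the Kummer class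
`κ(Q)` (`p • Q = P` rational) equals `κ(Q₁)` for any `Q₁` with `p • Q₁ = (p+1) • P = 2 • P₀`;
with `P₀ = Ψ(u)`, `u₁ = u²` (if `t ∈ F_v`) or `u₁ = u/σ₀(u)` (`σ₀ t = -t`; `Ψ(u₁) = 2 • P₀` by the
twisted equivariance, all `t`-movers agreeing on `u`), and `w^p = u₁`, `Q₁ = Ψ(w)`, one gets
`σ • Q₁ - Q₁ = Ψ(σw/w)` (`σ t = t`) or `Ψ((σw·w)⁻¹)` (`σ t ≠ t`), both in `Ψ(μ_p)`. The algebra is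
done for an abstract action (`section Abstract`), then at an `F`-field `E` (`section Local`).

References: [SilvermanATAEC1994] Ch. V, Thm. 3.1, Lemma 5.2, Thm. 5.3, Cor. 5.4 (PDF pp. 394–410);
[SerreInventiones1972] §1.12 (Prop. 13 and Cor.); [SilvermanAEC2009] VIII.§2, X.§4.
-/

set_option autoImplicit false
set_option linter.dupNamespace false -- directory name repeats the summit name (sibling precedent)

noncomputable section

open scoped Classical NumberField

open WeierstrassCurve Field IsDedekindDomain
  Literature.NumberTheory.EllipticCurves
  Literature.NumberTheory.GaloisRepresentations

namespace Summit.BirchSwinnertonDyer.BirchSwinnertonDyer.Theorems.GL1Cartan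

/-! ### Abstract algebra of a twisted parametrisation `Ψ : U → A` -/

section Abstract

variable {G U A : Type*} [Group G] [CommGroup U] [AddCommGroup A] [DistribMulAction G A]
  (H : Subgroup G) (g : G → U →* U) (Ψ : Additive U →+ A)

/-- **The norm-one unit above a rational point** (Silverman *ATAEC* Cor. V.5.4 with the twisted
equivariance of Lemma V.5.2 (c)). Let `g` be an action of `G` on `U`, `H ≤ G` a subgroup off
which any two elements compose into `H`, and `Ψ : U → A` with `σ • Ψ(x) = -Ψ(g σ x)` for
`σ ∉ H`. If `P₀ = Ψ(u)` is `G`-fixed with `u` fixed by `H`, there is `u₁` with `Ψ(u₁) = 2 • P₀`,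
`g σ u₁ = u₁` for `σ ∈ H`, and `(g σ u₁) u₁ = 1` for `σ ∉ H`: `u₁ = u²` if `H = G`, else
`u₁ = u / g σ₀ u` for any `σ₀ ∉ H` (`Ψ(g σ₀ u) = -P₀`, and all elements off `H` agree on `u`).
[cite: SilvermanATAEC1994, Lemma V.5.2 (c) and Cor. V.5.4 (PDF pp. 406–410)] -/
private theorem exists_unit_two_smul
    (hH : ∀ σ σ' : G, σ ∉ H → σ' ∉ H → σ * σ' ∈ H)
    (hg : ∀ (σ σ' : G) (u : U), g (σ * σ') u = g σ (g σ' u)) (hg1 : ∀ u : U, g 1 u = u)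
    (hneg : ∀ σ : G, σ ∉ H → ∀ u : U,
      σ • Ψ (Additive.ofMul u) = -Ψ (Additive.ofMul (g σ u)))
    {P₀ : A} (hP₀ : ∀ σ : G, σ • P₀ = P₀) {u : U} (hfix : ∀ σ ∈ H, g σ u = u)
    (hu : Ψ (Additive.ofMul u) = P₀) :
    ∃ u₁ : U, Ψ (Additive.ofMul u₁) = P₀ + P₀ ∧ (∀ σ ∈ H, g σ u₁ = u₁) ∧
      ∀ σ : G, σ ∉ H → g σ u₁ * u₁ = 1 := by
  by_cases hall : ∀ σ : G, σ ∈ H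
  · exact ⟨u * u, by rw [ofMul_mul, map_add, hu], fun σ hσ ↦ by rw [map_mul, hfix σ hσ],
      fun σ hσ ↦ (hσ (hall σ)).elim⟩
  push Not at hall
  obtain ⟨σ₀, hσ₀⟩ := hall
  -- two elements off `H` compose into `H`: `g σ (g σ' u) = u` for `σ, σ' ∉ H`
  have hmm : ∀ σ σ' : G, σ ∉ H → σ' ∉ H → g σ (g σ' u) = u :=
    fun σ σ' h h' ↦ by rw [← hg]; exact hfix _ (hH σ σ' h h')
  -- hence all elements off `H` agree on `u` (`g σ₀` is injective)
  have hinj : Function.Injective (g σ₀) := fun x y hxy ↦ by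
    have h := congrArg (g σ₀⁻¹) hxy
    rwa [← hg, ← hg, inv_mul_cancel, hg1, hg1] at h
  have hagree : ∀ σ : G, σ ∉ H → g σ u = g σ₀ u :=
    fun σ hσ ↦ hinj ((hmm σ₀ σ hσ₀ hσ).trans (hmm σ₀ σ₀ hσ₀ hσ₀).symm)
  -- and an element `σ` of `H` fixes `g σ₀ u` (`σ σ₀ ∉ H`)
  have hfm : ∀ σ ∈ H, g σ (g σ₀ u) = g σ₀ u := fun σ h ↦ by
    rw [← hg]
    exact hagree _ fun hm ↦ hσ₀ (by simpa using H.mul_mem (H.inv_mem h) hm)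
  have hΨσ₀ : Ψ (Additive.ofMul (g σ₀ u)) = -P₀ := by
    have h := hneg σ₀ hσ₀ u
    rw [hu, hP₀ σ₀] at h
    rw [h, neg_neg]
  exact ⟨u / g σ₀ u, by rw [ofMul_div, map_sub, hu, hΨσ₀, sub_neg_eq_add],
    fun σ hσ ↦ by rw [map_div, hfix σ hσ, hfm σ hσ],
    fun σ hσ ↦ by rw [map_div, hagree σ hσ, hmm σ σ₀ hσ hσ₀, div_mul_div_cancel, div_self']⟩

/-- **The Kummer cocycle of a `p`-th root of a norm-one unit is `μ_p`-valued.** With `u₁` as in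
`exists_unit_two_smul` and `w^p = u₁`: `σ • Ψ(w) - Ψ(w) = Ψ(ζ)` with `ζ^p = 1`
(`ζ = σw/w` if `σ ∈ H`, `ζ = (σw · w)⁻¹` otherwise).
[cite: SilvermanATAEC1994, Thm. V.3.1 (c),(d) and Lemma V.5.2 (c) (PDF pp. 394–407)] -/
private theorem exists_rootOfUnity_cocycle
    (hpos : ∀ σ ∈ H, ∀ u : U, σ • Ψ (Additive.ofMul u) = Ψ (Additive.ofMul (g σ u)))
    (hneg : ∀ σ : G, σ ∉ H → ∀ u : U,
      σ • Ψ (Additive.ofMul u) = -Ψ (Additive.ofMul (g σ u)))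
    {p : ℕ} {u₁ w : U} (hw : w ^ p = u₁) (h2 : ∀ σ ∈ H, g σ u₁ = u₁)
    (h3 : ∀ σ : G, σ ∉ H → g σ u₁ * u₁ = 1) (σ : G) :
    ∃ ζ : U, ζ ^ p = 1 ∧
      σ • Ψ (Additive.ofMul w) - Ψ (Additive.ofMul w) = Ψ (Additive.ofMul ζ) := by
  by_cases hσ : σ ∈ H
  · refine ⟨g σ w / w, ?_, ?_⟩
    · rw [div_pow, ← map_pow, hw, h2 σ hσ, div_self']
    · rw [hpos σ hσ w, ofMul_div, map_sub]
  · refine ⟨(g σ w * w)⁻¹, ?_, ?_⟩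
    · rw [inv_pow, mul_pow, ← map_pow, hw, h3 σ hσ, inv_one]
    · rw [hneg σ hσ w, ← neg_add', ← map_add, ← ofMul_mul, ← map_neg, ← ofMul_inv]

/-- **An element of `H` moves every `p`-torsion point into `Ψ(μ_p)`**: if `Ψ` is onto, its kernel
is pointwise `G`-fixed, and `p • R = 0`, then `R = Ψ(w)` with `Ψ(w^p) = 0`, so for `σ ∈ H`
`σ • R - R = Ψ(σw/w)` with `(σw/w)^p = σ(w^p)/w^p = 1` — the `(χ̄_p ∗; 0 1)` shape of
Serre 1972, §1.12 (Tate curve: `w^p ∈ q^ℤ ⊆ K_v`).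
[cite: SerreInventiones1972, §1.12, Prop. 13 and Cor.] -/
private theorem exists_rootOfUnity_smul_sub
    (hpos : ∀ σ ∈ H, ∀ u : U, σ • Ψ (Additive.ofMul u) = Ψ (Additive.ofMul (g σ u)))
    (hsurj : Function.Surjective Ψ)
    (hker : ∀ u : U, Ψ (Additive.ofMul u) = 0 → ∀ σ : G, g σ u = u)
    {p : ℕ} {σ : G} (hσ : σ ∈ H) {R : A} (hR : ((p : ℕ) : ℤ) • R = 0) :
    ∃ ζ : U, ζ ^ p = 1 ∧ σ • R - R = Ψ (Additive.ofMul ζ) := by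
  obtain ⟨a, rfl⟩ := hsurj R
  obtain ⟨w, rfl⟩ : ∃ w : U, Additive.ofMul w = a := ⟨Additive.toMul a, rfl⟩
  have hwp : Ψ (Additive.ofMul (w ^ p)) = 0 := by
    rw [ofMul_pow, map_nsmul, ← natCast_zsmul, hR]
  refine ⟨g σ w / w, ?_, ?_⟩
  · rw [div_pow, ← map_pow, hker _ hwp σ, div_self']
  · rw [hpos σ hσ w, ofMul_div, map_sub]

end Abstract

/-! ### The Tate line over a `F`-field `E` -/

section Local

variable {F : Type} [Field F] [CharZero F] (V : WeierstrassCurve F) [V.IsElliptic]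
  {E : Type} [Field E] [Algebra F E]

/-- **The Tate line, over any `F`-field `E` carrying a twisted parametrisation of `E(Ē)`.** Let
`H ≤ Γ_E` with `σσ' ∈ H` for `σ, σ' ∉ H`, `g` an action of `Γ_E` on `Ēˣ`, and
`Ψ : Ēˣ ↠ E(Ē) = localPoints V E` with pointwise-fixed kernel, `σ • Ψ(u) = ± Ψ(g σ u)` with sign
`+1` exactly on `H`, and every `Γ_E`-fixed point of the form `Ψ(u)` with `u` fixed by `H`
(Silverman *ATAEC* V.3.1, V.5.2 (c), V.5.3, V.5.4 at a multiplicative place, `H` = fixer of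
`√γ`). Then for an odd prime `p` the subgroup `X = E[p] ∩ Ψ(μ_p)` (read in `E(F̄)` through the
chosen embedding `pointsMap`) has `#X ≤ p`, receives `σ P - P` for `σ ∈ H`, `P ∈ E[p]`, and every
class of the local Kummer condition `V.kummerLocalConditionAt p E` is represented by an
`X`-valued continuous crossed homomorphism (the Kummer cocycle of `Q₁ = Ψ(w)`, `w^p = u₁` the
norm-one unit of `exists_unit_two_smul` above `((p+1)/2) • P`).
[cite: SilvermanATAEC1994, Thm. V.3.1, Lemma V.5.2 (c), Cor. V.5.4 (PDF pp. 394–410)] -/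
private theorem exists_tateLine (H : Subgroup (absoluteGaloisGroup E))
    (hH : ∀ σ σ' : absoluteGaloisGroup E, σ ∉ H → σ' ∉ H → σ * σ' ∈ H)
    (g : absoluteGaloisGroup E → (AlgebraicClosure E)ˣ →* (AlgebraicClosure E)ˣ)
    (hg : ∀ (σ σ' : absoluteGaloisGroup E) (u : (AlgebraicClosure E)ˣ),
      g (σ * σ') u = g σ (g σ' u)) (hg1 : ∀ u : (AlgebraicClosure E)ˣ, g 1 u = u)
    (Ψ : Additive (AlgebraicClosure E)ˣ →+ localPoints V E) (hsurj : Function.Surjective Ψ)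
    (hker : ∀ u : (AlgebraicClosure E)ˣ, Ψ (Additive.ofMul u) = 0 →
      ∀ σ : absoluteGaloisGroup E, g σ u = u)
    (hpos : ∀ σ ∈ H, ∀ u : (AlgebraicClosure E)ˣ,
      σ • Ψ (Additive.ofMul u) = Ψ (Additive.ofMul (g σ u)))
    (hneg : ∀ σ : absoluteGaloisGroup E, σ ∉ H → ∀ u : (AlgebraicClosure E)ˣ,
      σ • Ψ (Additive.ofMul u) = -Ψ (Additive.ofMul (g σ u)))
    (hrat : ∀ P : localPoints V E, (∀ σ : absoluteGaloisGroup E, σ • P = P) →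
      ∃ u : (AlgebraicClosure E)ˣ, (∀ σ ∈ H, g σ u = u) ∧ Ψ (Additive.ofMul u) = P)
    (p : ℕ) [hp : Fact p.Prime] {m : ℕ} (hm : p = 2 * m + 1) :
    ∃ X : AddSubgroup (V.geomTorsion (p : ℤ)), Nat.card X ≤ p ∧
      (∀ σ ∈ H, ∀ P : V.geomTorsion (p : ℤ), absGaloisRestrict F E σ • P - P ∈ X) ∧
      ∀ c ∈ V.kummerLocalConditionAt (p : ℤ) E,
        ∃ φ : contOneCocycles
            ((GaloisRep.restrictField E (V.torsionGaloisModule (p : ℤ))).toTopRep),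
          (∀ g, (φ.1 g : V.geomTorsion (p : ℤ)) ∈ X) ∧ oneCocycleClass _ φ = c := by
  have hpp : p.Prime := hp.out
  have hp0 : ((p : ℕ) : ℤ) ≠ 0 := by exact_mod_cast hpp.ne_zero
  haveI : NeZero p := ⟨hpp.ne_zero⟩
  -- the line `Y = Ψ(μ_p) ≤ E(Ē)` and `X = pointsMap⁻¹(Y) ∩ E[p]`
  set Y : AddSubgroup (localPoints V E) :=
    AddSubgroup.map Ψ (Subgroup.toAddSubgroup (rootsOfUnity p (AlgebraicClosure E))) with hYdef
  have hYmem : ∀ ζ : (AlgebraicClosure E)ˣ, ζ ^ p = 1 → Ψ (Additive.ofMul ζ) ∈ Y := by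
    intro ζ hζ
    refine AddSubgroup.mem_map_of_mem Ψ ?_
    rw [Additive.mem_toAddSubgroup, toMul_ofMul, mem_rootsOfUnity]
    exact hζ
  set X : AddSubgroup (V.geomTorsion (p : ℤ)) :=
    Y.comap ((pointsMap V E).comp (V.geomTorsion (p : ℤ)).subtype) with hXdef
  have hmemX : ∀ P : V.geomTorsion (p : ℤ), P ∈ X ↔ pointsMap V E (P : geomPoints V) ∈ Y :=
    fun P ↦ Iff.rfl
  refine ⟨X, ?_, ?_, ?_⟩
  · -- `#X ≤ #Y ≤ #μ_p ≤ p`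
    have hinj : Function.Injective
        (fun P : X ↦ (⟨pointsMap V E ((P : V.geomTorsion (p : ℤ)) : geomPoints V),
          (hmemX _).mp P.2⟩ : Y)) := by
      intro P Q h
      have h' : pointsMap V E ((P : V.geomTorsion (p : ℤ)) : geomPoints V) =
          pointsMap V E ((Q : V.geomTorsion (p : ℤ)) : geomPoints V) := congrArg Subtype.val h
      exact Subtype.ext (Subtype.ext (pointsMapOfEmb_injective V (closureEmb (K := F) E) h'))
    have hsurjY : Function.Surjective (fun ζ : rootsOfUnity p (AlgebraicClosure E) ↦
        (⟨Ψ (Additive.ofMul (ζ : (AlgebraicClosure E)ˣ)),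
          hYmem _ ((mem_rootsOfUnity _ _).mp ζ.2)⟩ : Y)) := by
      rintro ⟨R, hR⟩
      obtain ⟨a, ha, rfl⟩ := AddSubgroup.mem_map.mp hR
      rw [Additive.mem_toAddSubgroup] at ha
      exact ⟨⟨Additive.toMul a, ha⟩, rfl⟩
    haveI : Finite Y := Finite.of_surjective _ hsurjY
    calc Nat.card X ≤ Nat.card Y := Nat.card_le_card_of_injective _ hinj
      _ ≤ Nat.card (rootsOfUnity p (AlgebraicClosure E)) :=
        Nat.card_le_card_of_surjective _ hsurjY
      _ ≤ p := card_rootsOfUnity (AlgebraicClosure E) p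
  · -- (b) an element of `H` moves `E[p]` into `X`
    intro σ hσ P
    rw [hmemX]
    have hcoe : ((absGaloisRestrict F E σ • P - P : V.geomTorsion (p : ℤ)) : geomPoints V) =
        resGal (K := F) E σ • (P : geomPoints V) - (P : geomPoints V) := by
      rw [AddSubgroupClass.coe_sub,
        Literature.NumberTheory.EllipticCurves.AddSubgroup.torsionBy.coe_smul,
        resGal_eq_absGaloisRestrict]
    have hP0 : ((p : ℕ) : ℤ) • (P : geomPoints V) = 0 := (Submodule.mem_torsionBy_iff _ _).mp P.2
    have hR : ((p : ℕ) : ℤ) • pointsMap V E (P : geomPoints V) = 0 := by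
      rw [← map_zsmul, hP0, map_zero]
    rw [hcoe, map_sub, pointsMap_smul]
    obtain ⟨ζ, hζ, hEq⟩ := exists_rootOfUnity_smul_sub H g Ψ hpos hsurj hker hσ hR
    rw [hEq]
    exact hYmem ζ hζ
  · -- (a) every local Kummer class has an `X`-valued cocycle
    intro c hc
    obtain ⟨Q, hQ, rfl⟩ := V.exists_eq_localKummerClass_of_mem (p : ℤ) hp0 hc
    -- `P = p • Q` is rational, `P₀ = (m + 1) • P`, `2 • P₀ = (p + 1) • P`
    set P : localPoints V E := ((p : ℕ) : ℤ) • Q with hPdef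
    have hPfix : ∀ σ : absoluteGaloisGroup E, σ • P = P := hQ
    set P₀ : localPoints V E := ((m + 1 : ℕ) : ℤ) • P with hP₀def
    have hP₀fix : ∀ σ : absoluteGaloisGroup E, σ • P₀ = P₀ := fun σ ↦ by
      rw [hP₀def, smul_zsmul_localPoints, hPfix σ]
    -- `P₀ = Ψ(u)`, `u` fixed by `H` (Cor. V.5.4); the norm-one unit `u₁`, `Ψ(u₁) = 2 • P₀`
    obtain ⟨u, hfix, hu⟩ := hrat P₀ hP₀fix
    obtain ⟨u₁, hu₁, h2, h3⟩ := exists_unit_two_smul H g Ψ hH hg hg1 hneg hP₀fix hfix hu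
    -- a `p`-th root `w` of `u₁` and `Q₁ = Ψ(w)`
    obtain ⟨w₀, hw₀⟩ := IsAlgClosed.exists_pow_nat_eq (u₁ : AlgebraicClosure E) hpp.pos
    have hw₀0 : w₀ ≠ 0 := by
      rintro rfl
      rw [zero_pow hpp.ne_zero] at hw₀
      exact u₁.ne_zero hw₀.symm
    obtain ⟨w, hw⟩ : ∃ w : (AlgebraicClosure E)ˣ, w ^ p = u₁ :=
      ⟨Units.mk0 w₀ hw₀0, Units.ext (by rw [Units.val_pow_eq_pow_val, Units.val_mk0, hw₀])⟩
    set Q₁ : localPoints V E := Ψ (Additive.ofMul w) with hQ₁def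
    have hpQ₁ : ((p : ℕ) : ℤ) • Q₁ = P₀ + P₀ := by
      rw [hQ₁def, natCast_zsmul, ← map_nsmul, ← ofMul_pow, hw, hu₁]
    have hpQP : ((p : ℕ) : ℤ) • (Q + P) = P₀ + P₀ := by
      calc ((p : ℕ) : ℤ) • (Q + P) = P + ((p : ℕ) : ℤ) • P := by rw [zsmul_add]
        _ = ((1 : ℤ) + ((p : ℕ) : ℤ)) • P := by rw [add_zsmul, one_zsmul]
        _ = (((m + 1 : ℕ) : ℤ) + ((m + 1 : ℕ) : ℤ)) • P := by
          congr 1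
          rw [hm]; push_cast; ring
        _ = P₀ + P₀ := by rw [add_zsmul]
    have hQ₁' : ((p : ℕ) : ℤ) • Q₁ ∈
        MulAction.fixedPoints (absoluteGaloisGroup E) (localPoints V E) := by
      rw [hpQ₁]; intro σ; rw [smul_add, hP₀fix σ]
    have hQP' : ((p : ℕ) : ℤ) • (Q + P) ∈
        MulAction.fixedPoints (absoluteGaloisGroup E) (localPoints V E) := by
      rw [hpQP]; intro σ; rw [smul_add, hP₀fix σ]
    have hP' : ((p : ℕ) : ℤ) • P ∈
        MulAction.fixedPoints (absoluteGaloisGroup E) (localPoints V E) := by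
      intro σ; rw [smul_zsmul_localPoints, hPfix σ]
    -- `κ(Q₁) = κ(Q + P) = κ(Q) + κ(P) = κ(Q)`
    have hclass : V.localKummerClass (p : ℤ) hp0 Q₁ hQ₁' = V.localKummerClass (p : ℤ) hp0 Q hQ := by
      rw [V.localKummerClass_eq_of_zsmul_eq (p : ℤ) hp0 Q₁ (Q + P) hQ₁' hQP' (by rw [hpQ₁, hpQP]),
        V.localKummerClass_add (p : ℤ) hp0 Q P hQ hP' hQP',
        (V.localKummerClass_eq_zero_iff (p : ℤ) hp0 P hP').mpr
          ⟨0, zero_mem _, by rw [sub_zero]; exact hPfix⟩,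
        add_zero]
    refine ⟨V.localKummerCocycle (p : ℤ) hp0 Q₁ hQ₁', fun τ ↦ ?_, hclass⟩
    rw [hmemX, pointsMap_localKummerCocycle_apply]
    obtain ⟨ζ, hζ, hEq⟩ := exists_rootOfUnity_cocycle H g Ψ hpos hneg hw h2 h3 τ
    rw [hEq]
    exact hYmem ζ hζ

end Local

/-! ### The registered stub -/

/-- **Stub `stub_cartanLocalMult` of line gl1cartan5 (crux `PrintX11a.UpperNonSurjFive`): the Tate
line at a multiplicative place above an odd prime.** For an elliptic curve `V` over a number field
`F`, an odd prime `p`, and a finite place `v ∣ p` of multiplicative reduction, there is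
`X ≤ E[p]` with `#X ≤ p` such that (b) the inertia group `I_v ≤ Γ_F` of the chosen embedding
(`GreenbergSelmer.inertia v`) satisfies `τ P - P ∈ X` for all `τ ∈ I_v`, `P ∈ E[p]` (Serre 1972,
§1.12, Cor. of Prop. 13: `ρ̄|I_v = (χ̄_p ∗; 0 1)`), and (a) every class of the local Kummer
condition at `F_v` (the image of `E(F_v)/p` in `H¹(F_v, E[p])`) is the class of an `X`-valued
continuous crossed homomorphism. Proof: `exists_tateLine` for the stabiliser `H` of `t`
(`σ t = ± t`, so two `t`-movers compose to a `t`-fixer), fed with the tree's proved twisted `v`-adic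
uniformisation (Silverman *ATAEC* V.5.2 (c), V.5.3, V.5.4) and the unramifiedness of `F_v(√γ)/F_v`
at a multiplicative place (`TateCurve.toAlgEquiv_eq_of_mem_inertia_of_sq_eq_gamma`,
`I_𝔐 = absInertia F_v`).
[cite: SilvermanATAEC1994, Lemma V.5.2 (c), Thm. V.5.3, Cor. V.5.4 (PDF pp. 406–410)] -/
theorem stub_cartanLocalMult :
    ∀ (F : Type) [Field F] [NumberField F] (V : WeierstrassCurve F) [V.IsElliptic]
      (p : ℕ) [Fact p.Prime] (v : HeightOneSpectrum (𝓞 F)), p ≠ 2 → ((p : ℕ) : 𝓞 F) ∈ v.asIdeal →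
      V.HasMultiplicativeReductionAt v →
      ∃ X : AddSubgroup (V.geomTorsion (p : ℤ)), Nat.card X ≤ p ∧
        (∀ τ ∈ GreenbergSelmer.inertia v, ∀ P : V.geomTorsion (p : ℤ), τ • P - P ∈ X) ∧
        ∀ c ∈ V.kummerLocalConditionAt (p : ℤ) (v.adicCompletion F),
          ∃ φ : contOneCocycles
              ((GaloisRep.restrictField (v.adicCompletion F) (V.torsionGaloisModule (p : ℤ))).toTopRep),
            (∀ g, (φ.1 g : V.geomTorsion (p : ℤ)) ∈ X) ∧ oneCocycleClass _ φ = c := by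
  intro F _ _ V _ p hp v hp2 _hpv hmult
  obtain ⟨m, hm⟩ := hp.out.odd_of_ne_two hp2
  -- Tate's twisted `v`-adic uniformisation (Silverman ATAEC V.5.2 (c), V.5.3, V.5.4)
  obtain ⟨q, t, Ψ, -, -, -, ht, hsurj, hker, hequiv, hrat⟩ :=
    TateCurve.Silverman1994_thmV53_corV54_tateUniformisation_holds V v hmult
  -- the fixer `H` of `t`; `σ t = ± t`, so two `t`-movers compose to a `t`-fixer
  set H : Subgroup (absoluteGaloisGroup (v.adicCompletion F)) :=
    MulAction.stabilizer (absoluteGaloisGroup (v.adicCompletion F)) t with hHdef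
  have hmem : ∀ σ, σ ∈ H ↔ absoluteGaloisGroup.toAlgEquiv (v.adicCompletion F) σ t = t :=
    fun σ ↦ MulAction.mem_stabilizer_iff
  have hsign : ∀ σ, σ ∉ H → absoluteGaloisGroup.toAlgEquiv (v.adicCompletion F) σ t = -t :=
    fun σ hσ ↦ (sq_eq_sq_iff_eq_or_eq_neg.mp
      (by rw [← map_pow, ht, AlgEquiv.commutes])).resolve_left (fun h ↦ hσ ((hmem σ).mpr h))
  have hH : ∀ σ σ', σ ∉ H → σ' ∉ H → σ * σ' ∈ H := fun σ σ' h h' ↦ by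
    rw [hmem, map_mul, AlgEquiv.mul_apply, hsign σ' h', map_neg, hsign σ h, neg_neg]
  -- the Tate line for the action `σ ↦ Units.map σ` on `F̄_vˣ` (sign `+1` exactly on `H`)
  obtain ⟨X, hX, hline, hkummer⟩ := exists_tateLine V H hH
    (fun σ ↦ Units.map (absoluteGaloisGroup.toAlgEquiv (v.adicCompletion F) σ :
      AlgebraicClosure (v.adicCompletion F) →* AlgebraicClosure (v.adicCompletion F)))
    (fun σ σ' u ↦ Units.ext (by
      simp only [Units.coe_map, MonoidHom.coe_coe, map_mul, AlgEquiv.mul_apply]))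
    (fun u ↦ Units.ext (by simp only [Units.coe_map, MonoidHom.coe_coe, map_one]; rfl))
    Ψ hsurj
    (fun u hu σ ↦ by
      obtain ⟨n, hn⟩ := (hker u).mp hu
      exact Units.ext (by rw [Units.coe_map, MonoidHom.coe_coe, hn, map_zpow₀, AlgEquiv.commutes]))
    (fun σ hσ u ↦ by rw [hequiv σ u, if_pos ((hmem σ).mp hσ), one_zsmul])
    (fun σ hσ u ↦ by rw [hequiv σ u, if_neg (fun h ↦ hσ ((hmem σ).mpr h)), neg_one_zsmul])
    (fun P hP ↦ by
      obtain ⟨u, hfix, -, hu⟩ := hrat P hP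
      exact ⟨u, fun σ hσ ↦ hfix σ ((hmem σ).mp hσ), hu⟩)
    p hm
  refine ⟨X, hX, ?_, hkummer⟩
  -- the inertia group of the chosen embedding fixes `t` (the twist `F_v(t)/F_v` is unramified)
  obtain ⟨w, hw⟩ := v.exists_spectralValuation
  obtain ⟨𝔐, h𝔐⟩ := v.localPrimesAbove_nonempty
  intro τ hτ P
  obtain ⟨σ, hσ, rfl⟩ := Subgroup.mem_map.mp hτ
  rw [← IsDedekindDomain.HeightOneSpectrum.inertia_eq_absInertia hw h𝔐] at hσ
  exact hline σ ((hmem σ).mpr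
    (TateCurve.toAlgEquiv_eq_of_mem_inertia_of_sq_eq_gamma V hmult h𝔐 ht hσ)) P

end Summit.BirchSwinnertonDyer.BirchSwinnertonDyer.Theorems.GL1Cartan

end
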